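import Summits.BirchSwinnertonDyer.BirchSwinnertonDyer.Theorems.KolyvaginDepthDoorDepthTableRowsExactReadingZhang1
import Summits.BirchSwinnertonDyer.BirchSwinnertonDyer.Theorems.Rank2Observatory433a1TwoDescClRankTwo
import Summits.BirchSwinnertonDyer.BirchSwinnertonDyer.Theorems.Rank2Observatory563a1TwoDescClRankTwo
import Summits.BirchSwinnertonDyer.BirchSwinnertonDyer.Theorems.Rank2Observatory571b1TwoDescClRankTwo
import Summits.BirchSwinnertonDyer.BirchSwinnertonDyer.Theorems.KolyvaginDepthDoorDepthTableRowKitSecondSign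
import Summits.BirchSwinnertonDyer.BirchSwinnertonDyer.Theorems.KolyvaginDepthDoorKolyvaginDepthSupplyDoorNoTwist
import Summits.BirchSwinnertonDyer.BirchSwinnertonDyer.Theorems.Rank2ObservatoryKernelAnnihilator
import Literature.NumberTheory.EllipticCurves.IrreducibleModPQuadraticTwistProofs
import Literature.NumberTheory.EllipticCurves.NonEisensteinPrimeOfSurjective
import Literature.NumberTheory.EllipticCurves.LeadingTermProofs
import HarnessLib

/-!
# Route `KolyvaginDepthDoor`, crux `KolyvaginDepthSupplyKN` (stmt-BirchSwinnertonDyer-22820) —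
# DEPTH TABLE v12: «ONE BIT ⟺ TWO `Ш`'s» (1/4: `433a1`, `563a1`, `571b1`) — the rank-2 row in pure BSD-invariant
# form, the one point on the Heegner twist SUPPLIED IN THE KERNEL

Helper file of the lead prover of line `levelone` (kdd-p1 g15; `--supports stmt-BirchSwinnertonDyer-22820
--as helper`); it closes nothing and BSD is not proved by it.

v11 (this seat, files `…DepthTableRowsRankDischarged`, `…DepthTableRow<label>RankDischarged`) reads the
rank-2 rows as «bit ⟺ `Ш(E/ℚ)[p] = 0` ∧ `#Sel_p(E^{(d_K)}/ℚ) ≤ p`» (rank of `E` discharged by the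
tree's kernel 2-descent certificates). The remaining Selmer bound on the twist is itself two BSD
invariants once ONE rational point of infinite order on `E^{(d_K)}` is known: with `1 ≤ rank E^{(d_K)}`
and `E^{(d_K)}[p](ℚ) = 0` (twist of an irreducible `ρ̄_{E,p}`), `#Sel_p(E^{(d_K)}) ≤ p` ⟺
«`rank E^{(d_K)} = 1` ∧ `Ш(E^{(d_K)}/ℚ)[p] = 0`» (AEC X.4.2; `natCard_selmerGroup_le_iff_rank_eq_one_sha₁₅`
in part 1). This file SUPPLIES THAT POINT IN THE KERNEL for each row — a rational point on the integer
twist model `[0, d_K b₂, 0, 8 d_K² b₄, 16 d_K³ b₆]` (`u = 1/2`-isomorphic to `E^{(d_K)}`,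
`mordellWeilRank_quadraticTwist_eq_twistModel`), found by naive search, NON-ZERO, on a twist that is
TORSION-FREE by the annihilator `t = 1` of two kernel point counts (`nsmul_eq_zero_of_annihilatorCheck`),
hence of infinite order; Mordell–Weil (`module_finite_point_holds`) gives `1 ≤ rank` — and states:

  «∃ frame, Kolyvagin prime `ℓ`, datum: `c_1(ℓ) ≠ 0`»  `↔`
  «`Ш(E/ℚ)[p] = 0` ∧ `rank_ℤ E^{(d_K)}(ℚ) = 1` ∧ `Ш(E^{(d_K)}/ℚ)[p] = 0`»,

for ANY imaginary quadratic `K` with the row's `d_K`: ONE BIT of Jetchev–Lauter–Stein's algorithm IS the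
vanishing of `Ш[p]` of the rank-2 curve AND of its rank-1 Heegner twist (plus the twist's rank), with
nothing else in the statement — no rank of `E`, no `hF`, no twist pinning, no `Ш`-hypothesis, no point
hypothesis. CONDITIONAL on the named print facts of the v10/v11 rows ((γ) + W. Zhang L8.4 (1), resp.
Castella–Sano et al. on the split rows); per curve; BSD is NOT proved by any of this.

References: [WZhang2014] Lemma 8.4 (1) (p. 236), Thm. 9.1 (p. 240); [CastellaSano2026] Thm. 3;
[GrossLMS1991] Prop. 3.7 (2); [SilvermanAEC2009] VII.3.1 (b), VIII.6.7, X.4.2, X.5 Cor. 5.4;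
[JetchevLauterStein2009] §3.6 (arXiv:0707.0032); [CremonaAlgorithms1997] Table 1, §3.6.
-/

set_option linter.dupNamespace false

noncomputable section

open scoped Classical NumberField

namespace Summit.BirchSwinnertonDyer.BirchSwinnertonDyer.Theorems.KolyvaginDepthDoor

open Literature.NumberTheory.EllipticCurves Literature.NumberTheory.EllipticCurves.ModularForms
  WeierstrassCurve NumberField IsDedekindDomain
open Summit.BirchSwinnertonDyer.BirchSwinnertonDyer.Theorems
open Summit.BirchSwinnertonDyer.BirchSwinnertonDyer.Rank2Observatory

/-! ## The twist side of a bit, given ONE point of infinite order on the twist -/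

/-- **`#Sel_p(E') ≤ p` ⟺ «`rank E' = 1` ∧ `Ш(E')[p] = 0`», for `E'/ℚ` with `E'[p]` irreducible and ONE
rational point of infinite order** (`#Sel_p = p^{rank} · #E'(ℚ)[p] · #Ш(E')[p]`, AEC X.4.2; `→` is
`rank_and_sha_of_natCard_selmerGroup_le`, `←` is `natCard_selmerGroup_eq_pow_rank_of_sha_inf_torsionBy_eq_bot`).
UNCONDITIONAL. [cite: SilvermanAEC2009, Thm. X.4.2] -/
theorem natCard_selmerGroup_le_iff_rank_eq_one_sha₁₅ (W : WeierstrassCurve ℚ) [W.IsElliptic]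
    (p : ℕ) [hp : Fact p.Prime] (hirr : W.HasIrreducibleModPGaloisRep p) (h1 : 1 ≤ W.mordellWeilRank) :
    Nat.card (W.selmerGroup p) ≤ p ↔
      (W.mordellWeilRank = 1 ∧
        (W.sha ⊓ AddSubgroup.torsionBy W.galH1 (p : ℤ) : AddSubgroup W.galH1) = ⊥) := by
  constructor
  · intro h
    have h' : Nat.card ↥(selmerGroup W (p : ℤ)) ≤ p ^ 1 := by rw [pow_one]; exact h
    obtain ⟨hr, -, hbot, -⟩ := rank_and_sha_of_natCard_selmerGroup_le W hp.out.one_lt 1 h' h1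
    exact ⟨hr, hbot⟩
  · rintro ⟨hr, hbot⟩
    have h := natCard_selmerGroup_eq_pow_rank_of_sha_inf_torsionBy_eq_bot W p hirr hbot
    rw [hr, pow_one] at h
    exact h.le

/-! ## `433a1` at `(p, d_K) = (5, -8)`: twist model `[0, -8, 0, 0, -32768]`, kernel point `(76, 600)` -/

namespace C433a1

/-- The twist model of `E^{(−8)}` for `E = 433a1`: `[0, −8 b₂, 0, 8·8² b₄, −16·8³ b₆] = [0, -8, 0, 0, -32768]`
(`ℚ`-isomorphic to `E^{(−8)}` by `u = 1/2`). [cite: SilvermanAEC2009, X.5 Cor. 5.4] -/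
theorem twistModel_neg8 :
    (⟨0, (-8) * (⟨1, 0, 0, 0, 1⟩ : WeierstrassCurve ℤ).b₂, 0, 8 * (-8) ^ 2 * (⟨1, 0, 0, 0, 1⟩ : WeierstrassCurve ℤ).b₄,
        16 * (-8) ^ 3 * (⟨1, 0, 0, 0, 1⟩ : WeierstrassCurve ℤ).b₆⟩ : WeierstrassCurve ℤ) = ⟨0, -8, 0, 0, -32768⟩ := by
  ext <;> decide +kernel

/-- The twist model `[0, -8, 0, 0, -32768]` is an elliptic curve over `ℚ` (`Δ ≠ 0`, kernel-checked). [folklore] -/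
theorem isElliptic_twist_neg8 : ((⟨0, -8, 0, 0, -32768⟩ : WeierstrassCurve ℤ).map (Int.castRingHom ℚ)).IsElliptic := by
  rw [WeierstrassCurve.isElliptic_iff, WeierstrassCurve.map_Δ, isUnit_iff_ne_zero, eq_intCast,
    Int.cast_ne_zero]
  decide +kernel

/-- Torsion killers for the twist model `[0, -8, 0, 0, -32768]`: kernel point counts `(q, #Ṽ(𝔽_q))` at the good
primes `(3, 6), (7, 5)`. [cite: SilvermanAEC2009, Prop. VII.3.1 (b)] -/
theorem killers_twist_neg8 : ∀ ℓN ∈ [((3 : ℕ), (6 : ℕ)), ((7 : ℕ), (5 : ℕ))], ℓN.1.Prime ∧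
    ∀ (x : ((⟨0, -8, 0, 0, -32768⟩ : WeierstrassCurve ℤ).map (Int.castRingHom ℚ)).toAffine.Point)
      (n : ℕ), ¬ ℓN.1 ∣ n → n • x = 0 → ℓN.2 • x = 0 :=
  killers_cons _ (q := 3) (N := 6) (by decide +kernel) (by decide +kernel)
    (killers_cons _ (q := 7) (N := 5) (by decide +kernel) (by decide +kernel)
      (killers_nil _))

/-- **`E^{(−8)}(ℚ)` is torsion-free** (`E = 433a1`; twist model `[0, -8, 0, 0, -32768]`; annihilator `t = 1` from the
kernel counts `(3, 6), (7, 5)`). [cite: SilvermanAEC2009, Prop. VII.3.1 (b)] -/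
theorem torsionFree_twist_neg8 (x : ((⟨0, -8, 0, 0, -32768⟩ : WeierstrassCurve ℤ).map (Int.castRingHom ℚ)).toAffine.Point)
    (hx : IsOfFinAddOrder x) : x = 0 := by
  simpa only [one_smul] using
    nsmul_eq_zero_of_annihilatorCheck (t := 1) killers_twist_neg8 (by decide +kernel) hx

/-- **`1 ≤ rank_ℤ E^{(−8)}(ℚ)` for `E = 433a1` IN THE KERNEL**: the rational point `(76, 600)` of the
twist model `[0, -8, 0, 0, -32768]` (naive search) is non-zero on a torsion-free curve, hence of infinite order;
Mordell–Weil. [cite: SilvermanAEC2009, Prop. VII.3.1 (b) and Thm. VIII.6.7] -/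
theorem one_le_rank_twist_neg8 :
    1 ≤ ((⟨0, -8, 0, 0, -32768⟩ : WeierstrassCurve ℤ).map (Int.castRingHom ℚ)).mordellWeilRank := by
  haveI := isElliptic_twist_neg8
  have hP : ((⟨0, -8, 0, 0, -32768⟩ : WeierstrassCurve ℤ).map (Int.castRingHom ℚ)).toAffine.Nonsingular
      ((76 : ℚ)) ((600 : ℚ)) :=
    WeierstrassCurve.Affine.equation_iff_nonsingular.mp
      ((WeierstrassCurve.Affine.equation_iff _ _).mpr (by norm_num [WeierstrassCurve.map]))
  exact one_le_mordellWeilRank_of_not_isOfFinAddOrder _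
    (((⟨0, -8, 0, 0, -32768⟩ : WeierstrassCurve ℤ).map (Int.castRingHom ℚ)).module_finite_point_holds)
    (fun hfin ↦ WeierstrassCurve.Affine.Point.some_ne_zero hP (torsionFree_twist_neg8 _ (by convert hfin)))

/-- **DEPTH-TABLE ROW `433a1`, `(p, d_K) = (5, −8)`, v12 — «ONE BIT ⟺ TWO `Ш`'s».** For `E = 433a1` and ANY
imaginary quadratic `K` with `d_K = −8`: «some frame, some Kolyvagin prime `ℓ`, some datum of conductor
`ℓ` with `c_1(ℓ) ≠ 0`» `↔` «`Ш(E/ℚ)[5] = 0` ∧ `rank_ℤ E^{(−8)}(ℚ) = 1` ∧ `Ш(E^{(−8)}/ℚ)[5] = 0`». From the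
row `C433a1.exactRowZhang_5_neg8` (rank discharged by the kernel 2-descent certificate) and `natCard_selmerGroup_le_iff_rank_eq_one_sha₁₅` at the twist, fed with
the kernel point `one_le_rank_twist_neg8` (through `mordellWeilRank_quadraticTwist_eq_twistModel`) and
the irreducibility of `E^{(−8)}[5]` (twist of the onto `ρ̄_{E,5}`). Every side condition is a kernel
theorem; CONDITIONAL on (γ) and W. Zhang's Lemma 8.4 (1) / Thm. 9.1 by name; per curve; BSD is not proved by it.
[cite: WZhang2014, Lemma 8.4 (1) (p. 236), Thm. 9.1 (p. 240)] [cite: GrossLMS1991, Prop. 3.7 (2)]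
[cite: SilvermanAEC2009, Thm. X.4.2] [cite: CremonaAlgorithms1997, Table 1 (433a1)] -/
theorem exactRowZhang_5_neg8_twoSha
    (h372 : GrossLMS1991.prop37_2_frobeniusCongruence)
    (h84 : Literature.NumberTheory.EllipticCurves.WZhang2014_lemma84_exists_minimal_kolyvaginClass_one_selmerCard)
    (K : Type) [Field K] [NumberField K] (hK : IsImaginaryQuadratic K)
    (hD : NumberField.discr K = -8) :
    haveI := isElliptic_c433a1;
    haveI := isGloballyMinimal_c433a1;
    haveI : NeZero (((⟨1, 0, 0, 0, 1⟩ : WeierstrassCurve ℤ).map (Int.castRingHom ℚ)).conductorNorm ℤ) := neZero_conductorNorm_of_isElliptic _;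
    haveI := Fact.mk (by norm_num : Nat.Prime 5);
    (∃ (Dt : ModularParametrizationData ((⟨1, 0, 0, 0, 1⟩ : WeierstrassCurve ℤ).map (Int.castRingHom ℚ)) (((⟨1, 0, 0, 0, 1⟩ : WeierstrassCurve ℤ).map (Int.castRingHom ℚ)).conductorNorm ℤ)) (β : ℤ)
      (ι : K →+* ℂ) (ℓ : ℕ) (d : KolyvaginHeegnerData Dt β ι ℓ),
      ℓ.Prime ∧ Zhang2014.IsKolyvaginPrime (((⟨1, 0, 0, 0, 1⟩ : WeierstrassCurve ℤ).map (Int.castRingHom ℚ)).conductorNorm ℤ) ((⟨1, 0, 0, 0, 1⟩ : WeierstrassCurve ℤ).map (Int.castRingHom ℚ)) K 5 ℓ ∧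
        d.kolyvaginClass (p := 5) (by norm_num) 1 ≠ 0) ↔
    ((((⟨1, 0, 0, 0, 1⟩ : WeierstrassCurve ℤ).map (Int.castRingHom ℚ)).sha ⊓ AddSubgroup.torsionBy ((⟨1, 0, 0, 0, 1⟩ : WeierstrassCurve ℤ).map (Int.castRingHom ℚ)).galH1 ((5 : ℕ) : ℤ) : AddSubgroup _) = ⊥ ∧
      (((⟨1, 0, 0, 0, 1⟩ : WeierstrassCurve ℤ).map (Int.castRingHom ℚ)).quadraticTwist (NumberField.discr K : ℚ)).mordellWeilRank = 1 ∧
      ((((⟨1, 0, 0, 0, 1⟩ : WeierstrassCurve ℤ).map (Int.castRingHom ℚ)).quadraticTwist (NumberField.discr K : ℚ)).sha ⊓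
          AddSubgroup.torsionBy (((⟨1, 0, 0, 0, 1⟩ : WeierstrassCurve ℤ).map (Int.castRingHom ℚ)).quadraticTwist (NumberField.discr K : ℚ)).galH1 ((5 : ℕ) : ℤ) :
          AddSubgroup (((⟨1, 0, 0, 0, 1⟩ : WeierstrassCurve ℤ).map (Int.castRingHom ℚ)).quadraticTwist (NumberField.discr K : ℚ)).galH1) = ⊥) := by
  haveI := isElliptic_c433a1
  haveI := isGloballyMinimal_c433a1
  haveI : NeZero (((⟨1, 0, 0, 0, 1⟩ : WeierstrassCurve ℤ).map (Int.castRingHom ℚ)).conductorNorm ℤ) := neZero_conductorNorm_of_isElliptic _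
  haveI := Fact.mk (by norm_num : Nat.Prime 5)
  have hdK : (NumberField.discr K : ℚ) ≠ 0 := by exact_mod_cast NumberField.discr_ne_zero K
  haveI := ((⟨1, 0, 0, 0, 1⟩ : WeierstrassCurve ℤ).map (Int.castRingHom ℚ)).isElliptic_quadraticTwist hdK
  have hsur : ((⟨1, 0, 0, 0, 1⟩ : WeierstrassCurve ℤ).map (Int.castRingHom ℚ)).HasSurjectiveModNGaloisRep (5 ^ 1 : ℕ) := hasSurjectiveModNGaloisRep_pow_5 1
  rw [pow_one] at hsur
  have hirrT : (((⟨1, 0, 0, 0, 1⟩ : WeierstrassCurve ℤ).map (Int.castRingHom ℚ)).quadraticTwist (NumberField.discr K : ℚ)).HasIrreducibleModPGaloisRep 5 :=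
    (((⟨1, 0, 0, 0, 1⟩ : WeierstrassCurve ℤ).map (Int.castRingHom ℚ)).hasIrreducibleModPGaloisRep_quadraticTwist_iff hdK 5).mpr
      (hasIrreducibleModPGaloisRep_of_hasSurjectiveModNGaloisRep ((⟨1, 0, 0, 0, 1⟩ : WeierstrassCurve ℤ).map (Int.castRingHom ℚ)) 5 hsur)
  have h1 : 1 ≤ (((⟨1, 0, 0, 0, 1⟩ : WeierstrassCurve ℤ).map (Int.castRingHom ℚ)).quadraticTwist (NumberField.discr K : ℚ)).mordellWeilRank := by
    rw [hD, mordellWeilRank_quadraticTwist_eq_twistModel intModel (-8), twistModel_neg8]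
    exact one_le_rank_twist_neg8
  exact (exactRowZhang_5_neg8 h372 h84 K hK hD).trans
    ((and_iff_right Summit.BirchSwinnertonDyer.BirchSwinnertonDyer.Rank2Observatory.C433a1.mordellWeilRank_eq_two).trans
      (and_congr_right fun _ ↦ natCard_selmerGroup_le_iff_rank_eq_one_sha₁₅ _ 5 hirrT h1))

end C433a1

/-! ## `563a1` at `(p, d_K) = (5, -8)`: twist model `[0, -40, 0, -14848, -532480]`, kernel point `(10060/49, 631240/343)` -/

namespace C563a1

/-- The twist model of `E^{(−8)}` for `E = 563a1`: `[0, −8 b₂, 0, 8·8² b₄, −16·8³ b₆] = [0, -40, 0, -14848, -532480]`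
(`ℚ`-isomorphic to `E^{(−8)}` by `u = 1/2`). [cite: SilvermanAEC2009, X.5 Cor. 5.4] -/
theorem twistModel_neg8 :
    (⟨0, (-8) * (⟨1, 1, 1, -15, 16⟩ : WeierstrassCurve ℤ).b₂, 0, 8 * (-8) ^ 2 * (⟨1, 1, 1, -15, 16⟩ : WeierstrassCurve ℤ).b₄,
        16 * (-8) ^ 3 * (⟨1, 1, 1, -15, 16⟩ : WeierstrassCurve ℤ).b₆⟩ : WeierstrassCurve ℤ) = ⟨0, -40, 0, -14848, -532480⟩ := by
  ext <;> decide +kernel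

/-- The twist model `[0, -40, 0, -14848, -532480]` is an elliptic curve over `ℚ` (`Δ ≠ 0`, kernel-checked). [folklore] -/
theorem isElliptic_twist_neg8 : ((⟨0, -40, 0, -14848, -532480⟩ : WeierstrassCurve ℤ).map (Int.castRingHom ℚ)).IsElliptic := by
  rw [WeierstrassCurve.isElliptic_iff, WeierstrassCurve.map_Δ, isUnit_iff_ne_zero, eq_intCast,
    Int.cast_ne_zero]
  decide +kernel

/-- Torsion killers for the twist model `[0, -40, 0, -14848, -532480]`: kernel point counts `(q, #Ṽ(𝔽_q))` at the good
primes `(3, 5), (11, 16)`. [cite: SilvermanAEC2009, Prop. VII.3.1 (b)] -/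
theorem killers_twist_neg8 : ∀ ℓN ∈ [((3 : ℕ), (5 : ℕ)), ((11 : ℕ), (16 : ℕ))], ℓN.1.Prime ∧
    ∀ (x : ((⟨0, -40, 0, -14848, -532480⟩ : WeierstrassCurve ℤ).map (Int.castRingHom ℚ)).toAffine.Point)
      (n : ℕ), ¬ ℓN.1 ∣ n → n • x = 0 → ℓN.2 • x = 0 :=
  killers_cons _ (q := 3) (N := 5) (by decide +kernel) (by decide +kernel)
    (killers_cons _ (q := 11) (N := 16) (by decide +kernel) (by decide +kernel)
      (killers_nil _))

/-- **`E^{(−8)}(ℚ)` is torsion-free** (`E = 563a1`; twist model `[0, -40, 0, -14848, -532480]`; annihilator `t = 1` from the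
kernel counts `(3, 5), (11, 16)`). [cite: SilvermanAEC2009, Prop. VII.3.1 (b)] -/
theorem torsionFree_twist_neg8 (x : ((⟨0, -40, 0, -14848, -532480⟩ : WeierstrassCurve ℤ).map (Int.castRingHom ℚ)).toAffine.Point)
    (hx : IsOfFinAddOrder x) : x = 0 := by
  simpa only [one_smul] using
    nsmul_eq_zero_of_annihilatorCheck (t := 1) killers_twist_neg8 (by decide +kernel) hx

/-- **`1 ≤ rank_ℤ E^{(−8)}(ℚ)` for `E = 563a1` IN THE KERNEL**: the rational point `(10060/49, 631240/343)` of the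
twist model `[0, -40, 0, -14848, -532480]` (naive search) is non-zero on a torsion-free curve, hence of infinite order;
Mordell–Weil. [cite: SilvermanAEC2009, Prop. VII.3.1 (b) and Thm. VIII.6.7] -/
theorem one_le_rank_twist_neg8 :
    1 ≤ ((⟨0, -40, 0, -14848, -532480⟩ : WeierstrassCurve ℤ).map (Int.castRingHom ℚ)).mordellWeilRank := by
  haveI := isElliptic_twist_neg8
  have hP : ((⟨0, -40, 0, -14848, -532480⟩ : WeierstrassCurve ℤ).map (Int.castRingHom ℚ)).toAffine.Nonsingular
      (((10060 : ℚ) / 49)) (((631240 : ℚ) / 343)) :=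
    WeierstrassCurve.Affine.equation_iff_nonsingular.mp
      ((WeierstrassCurve.Affine.equation_iff _ _).mpr (by norm_num [WeierstrassCurve.map]))
  exact one_le_mordellWeilRank_of_not_isOfFinAddOrder _
    (((⟨0, -40, 0, -14848, -532480⟩ : WeierstrassCurve ℤ).map (Int.castRingHom ℚ)).module_finite_point_holds)
    (fun hfin ↦ WeierstrassCurve.Affine.Point.some_ne_zero hP (torsionFree_twist_neg8 _ (by convert hfin)))

/-- **DEPTH-TABLE ROW `563a1`, `(p, d_K) = (5, −8)`, v12 — «ONE BIT ⟺ TWO `Ш`'s».** For `E = 563a1` and ANY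
imaginary quadratic `K` with `d_K = −8`: «some frame, some Kolyvagin prime `ℓ`, some datum of conductor
`ℓ` with `c_1(ℓ) ≠ 0`» `↔` «`Ш(E/ℚ)[5] = 0` ∧ `rank_ℤ E^{(−8)}(ℚ) = 1` ∧ `Ш(E^{(−8)}/ℚ)[5] = 0`». From the
row `C563a1.exactRowZhang_5_neg8` (rank discharged by the kernel 2-descent certificate) and `natCard_selmerGroup_le_iff_rank_eq_one_sha₁₅` at the twist, fed with
the kernel point `one_le_rank_twist_neg8` (through `mordellWeilRank_quadraticTwist_eq_twistModel`) and
the irreducibility of `E^{(−8)}[5]` (twist of the onto `ρ̄_{E,5}`). Every side condition is a kernel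
theorem; CONDITIONAL on (γ) and W. Zhang's Lemma 8.4 (1) / Thm. 9.1 by name; per curve; BSD is not proved by it.
[cite: WZhang2014, Lemma 8.4 (1) (p. 236), Thm. 9.1 (p. 240)] [cite: GrossLMS1991, Prop. 3.7 (2)]
[cite: SilvermanAEC2009, Thm. X.4.2] [cite: CremonaAlgorithms1997, Table 1 (563a1)] -/
theorem exactRowZhang_5_neg8_twoSha
    (h372 : GrossLMS1991.prop37_2_frobeniusCongruence)
    (h84 : Literature.NumberTheory.EllipticCurves.WZhang2014_lemma84_exists_minimal_kolyvaginClass_one_selmerCard)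
    (K : Type) [Field K] [NumberField K] (hK : IsImaginaryQuadratic K)
    (hD : NumberField.discr K = -8) :
    haveI := isElliptic_c563a1;
    haveI := isGloballyMinimal_c563a1;
    haveI : NeZero (((⟨1, 1, 1, -15, 16⟩ : WeierstrassCurve ℤ).map (Int.castRingHom ℚ)).conductorNorm ℤ) := neZero_conductorNorm_of_isElliptic _;
    haveI := Fact.mk (by norm_num : Nat.Prime 5);
    (∃ (Dt : ModularParametrizationData ((⟨1, 1, 1, -15, 16⟩ : WeierstrassCurve ℤ).map (Int.castRingHom ℚ)) (((⟨1, 1, 1, -15, 16⟩ : WeierstrassCurve ℤ).map (Int.castRingHom ℚ)).conductorNorm ℤ)) (β : ℤ)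
      (ι : K →+* ℂ) (ℓ : ℕ) (d : KolyvaginHeegnerData Dt β ι ℓ),
      ℓ.Prime ∧ Zhang2014.IsKolyvaginPrime (((⟨1, 1, 1, -15, 16⟩ : WeierstrassCurve ℤ).map (Int.castRingHom ℚ)).conductorNorm ℤ) ((⟨1, 1, 1, -15, 16⟩ : WeierstrassCurve ℤ).map (Int.castRingHom ℚ)) K 5 ℓ ∧
        d.kolyvaginClass (p := 5) (by norm_num) 1 ≠ 0) ↔
    ((((⟨1, 1, 1, -15, 16⟩ : WeierstrassCurve ℤ).map (Int.castRingHom ℚ)).sha ⊓ AddSubgroup.torsionBy ((⟨1, 1, 1, -15, 16⟩ : WeierstrassCurve ℤ).map (Int.castRingHom ℚ)).galH1 ((5 : ℕ) : ℤ) : AddSubgroup _) = ⊥ ∧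
      (((⟨1, 1, 1, -15, 16⟩ : WeierstrassCurve ℤ).map (Int.castRingHom ℚ)).quadraticTwist (NumberField.discr K : ℚ)).mordellWeilRank = 1 ∧
      ((((⟨1, 1, 1, -15, 16⟩ : WeierstrassCurve ℤ).map (Int.castRingHom ℚ)).quadraticTwist (NumberField.discr K : ℚ)).sha ⊓
          AddSubgroup.torsionBy (((⟨1, 1, 1, -15, 16⟩ : WeierstrassCurve ℤ).map (Int.castRingHom ℚ)).quadraticTwist (NumberField.discr K : ℚ)).galH1 ((5 : ℕ) : ℤ) :
          AddSubgroup (((⟨1, 1, 1, -15, 16⟩ : WeierstrassCurve ℤ).map (Int.castRingHom ℚ)).quadraticTwist (NumberField.discr K : ℚ)).galH1) = ⊥) := by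
  haveI := isElliptic_c563a1
  haveI := isGloballyMinimal_c563a1
  haveI : NeZero (((⟨1, 1, 1, -15, 16⟩ : WeierstrassCurve ℤ).map (Int.castRingHom ℚ)).conductorNorm ℤ) := neZero_conductorNorm_of_isElliptic _
  haveI := Fact.mk (by norm_num : Nat.Prime 5)
  have hdK : (NumberField.discr K : ℚ) ≠ 0 := by exact_mod_cast NumberField.discr_ne_zero K
  haveI := ((⟨1, 1, 1, -15, 16⟩ : WeierstrassCurve ℤ).map (Int.castRingHom ℚ)).isElliptic_quadraticTwist hdK
  have hsur : ((⟨1, 1, 1, -15, 16⟩ : WeierstrassCurve ℤ).map (Int.castRingHom ℚ)).HasSurjectiveModNGaloisRep (5 ^ 1 : ℕ) := hasSurjectiveModNGaloisRep_pow_5 1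
  rw [pow_one] at hsur
  have hirrT : (((⟨1, 1, 1, -15, 16⟩ : WeierstrassCurve ℤ).map (Int.castRingHom ℚ)).quadraticTwist (NumberField.discr K : ℚ)).HasIrreducibleModPGaloisRep 5 :=
    (((⟨1, 1, 1, -15, 16⟩ : WeierstrassCurve ℤ).map (Int.castRingHom ℚ)).hasIrreducibleModPGaloisRep_quadraticTwist_iff hdK 5).mpr
      (hasIrreducibleModPGaloisRep_of_hasSurjectiveModNGaloisRep ((⟨1, 1, 1, -15, 16⟩ : WeierstrassCurve ℤ).map (Int.castRingHom ℚ)) 5 hsur)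
  have h1 : 1 ≤ (((⟨1, 1, 1, -15, 16⟩ : WeierstrassCurve ℤ).map (Int.castRingHom ℚ)).quadraticTwist (NumberField.discr K : ℚ)).mordellWeilRank := by
    rw [hD, mordellWeilRank_quadraticTwist_eq_twistModel intModel (-8), twistModel_neg8]
    exact one_le_rank_twist_neg8
  exact (exactRowZhang_5_neg8 h372 h84 K hK hD).trans
    ((and_iff_right Summit.BirchSwinnertonDyer.BirchSwinnertonDyer.Rank2Observatory.C563a1.mordellWeilRank_eq_two).trans
      (and_congr_right fun _ ↦ natCard_selmerGroup_le_iff_rank_eq_one_sha₁₅ _ 5 hirrT h1))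

end C563a1

/-! ## `571b1` at `(p, d_K) = (5, -8)`: twist model `[0, -32, 0, -4096, -73728]`, kernel point `(89, 115)` -/

namespace C571b1

/-- The twist model of `E^{(−8)}` for `E = 571b1`: `[0, −8 b₂, 0, 8·8² b₄, −16·8³ b₆] = [0, -32, 0, -4096, -73728]`
(`ℚ`-isomorphic to `E^{(−8)}` by `u = 1/2`). [cite: SilvermanAEC2009, X.5 Cor. 5.4] -/
theorem twistModel_neg8 :
    (⟨0, (-8) * (⟨0, 1, 1, -4, 2⟩ : WeierstrassCurve ℤ).b₂, 0, 8 * (-8) ^ 2 * (⟨0, 1, 1, -4, 2⟩ : WeierstrassCurve ℤ).b₄,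
        16 * (-8) ^ 3 * (⟨0, 1, 1, -4, 2⟩ : WeierstrassCurve ℤ).b₆⟩ : WeierstrassCurve ℤ) = ⟨0, -32, 0, -4096, -73728⟩ := by
  ext <;> decide +kernel

/-- The twist model `[0, -32, 0, -4096, -73728]` is an elliptic curve over `ℚ` (`Δ ≠ 0`, kernel-checked). [folklore] -/
theorem isElliptic_twist_neg8 : ((⟨0, -32, 0, -4096, -73728⟩ : WeierstrassCurve ℤ).map (Int.castRingHom ℚ)).IsElliptic := by
  rw [WeierstrassCurve.isElliptic_iff, WeierstrassCurve.map_Δ, isUnit_iff_ne_zero, eq_intCast,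
    Int.cast_ne_zero]
  decide +kernel

/-- Torsion killers for the twist model `[0, -32, 0, -4096, -73728]`: kernel point counts `(q, #Ṽ(𝔽_q))` at the good
primes `(5, 4), (13, 9)`. [cite: SilvermanAEC2009, Prop. VII.3.1 (b)] -/
theorem killers_twist_neg8 : ∀ ℓN ∈ [((5 : ℕ), (4 : ℕ)), ((13 : ℕ), (9 : ℕ))], ℓN.1.Prime ∧
    ∀ (x : ((⟨0, -32, 0, -4096, -73728⟩ : WeierstrassCurve ℤ).map (Int.castRingHom ℚ)).toAffine.Point)
      (n : ℕ), ¬ ℓN.1 ∣ n → n • x = 0 → ℓN.2 • x = 0 :=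
  killers_cons _ (q := 5) (N := 4) (by decide +kernel) (by decide +kernel)
    (killers_cons _ (q := 13) (N := 9) (by decide +kernel) (by decide +kernel)
      (killers_nil _))

/-- **`E^{(−8)}(ℚ)` is torsion-free** (`E = 571b1`; twist model `[0, -32, 0, -4096, -73728]`; annihilator `t = 1` from the
kernel counts `(5, 4), (13, 9)`). [cite: SilvermanAEC2009, Prop. VII.3.1 (b)] -/
theorem torsionFree_twist_neg8 (x : ((⟨0, -32, 0, -4096, -73728⟩ : WeierstrassCurve ℤ).map (Int.castRingHom ℚ)).toAffine.Point)
    (hx : IsOfFinAddOrder x) : x = 0 := by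
  simpa only [one_smul] using
    nsmul_eq_zero_of_annihilatorCheck (t := 1) killers_twist_neg8 (by decide +kernel) hx

/-- **`1 ≤ rank_ℤ E^{(−8)}(ℚ)` for `E = 571b1` IN THE KERNEL**: the rational point `(89, 115)` of the
twist model `[0, -32, 0, -4096, -73728]` (naive search) is non-zero on a torsion-free curve, hence of infinite order;
Mordell–Weil. [cite: SilvermanAEC2009, Prop. VII.3.1 (b) and Thm. VIII.6.7] -/
theorem one_le_rank_twist_neg8 :
    1 ≤ ((⟨0, -32, 0, -4096, -73728⟩ : WeierstrassCurve ℤ).map (Int.castRingHom ℚ)).mordellWeilRank := by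
  haveI := isElliptic_twist_neg8
  have hP : ((⟨0, -32, 0, -4096, -73728⟩ : WeierstrassCurve ℤ).map (Int.castRingHom ℚ)).toAffine.Nonsingular
      ((89 : ℚ)) ((115 : ℚ)) :=
    WeierstrassCurve.Affine.equation_iff_nonsingular.mp
      ((WeierstrassCurve.Affine.equation_iff _ _).mpr (by norm_num [WeierstrassCurve.map]))
  exact one_le_mordellWeilRank_of_not_isOfFinAddOrder _
    (((⟨0, -32, 0, -4096, -73728⟩ : WeierstrassCurve ℤ).map (Int.castRingHom ℚ)).module_finite_point_holds)
    (fun hfin ↦ WeierstrassCurve.Affine.Point.some_ne_zero hP (torsionFree_twist_neg8 _ (by convert hfin)))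

/-- **DEPTH-TABLE ROW `571b1`, `(p, d_K) = (5, −8)`, v12 — «ONE BIT ⟺ TWO `Ш`'s».** For `E = 571b1` and ANY
imaginary quadratic `K` with `d_K = −8`: «some frame, some Kolyvagin prime `ℓ`, some datum of conductor
`ℓ` with `c_1(ℓ) ≠ 0`» `↔` «`Ш(E/ℚ)[5] = 0` ∧ `rank_ℤ E^{(−8)}(ℚ) = 1` ∧ `Ш(E^{(−8)}/ℚ)[5] = 0`». From the
row `C571b1.exactRowZhang_5_neg8` (rank discharged by the kernel 2-descent certificate) and `natCard_selmerGroup_le_iff_rank_eq_one_sha₁₅` at the twist, fed with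
the kernel point `one_le_rank_twist_neg8` (through `mordellWeilRank_quadraticTwist_eq_twistModel`) and
the irreducibility of `E^{(−8)}[5]` (twist of the onto `ρ̄_{E,5}`). Every side condition is a kernel
theorem; CONDITIONAL on (γ) and W. Zhang's Lemma 8.4 (1) / Thm. 9.1 by name; per curve; BSD is not proved by it.
[cite: WZhang2014, Lemma 8.4 (1) (p. 236), Thm. 9.1 (p. 240)] [cite: GrossLMS1991, Prop. 3.7 (2)]
[cite: SilvermanAEC2009, Thm. X.4.2] [cite: CremonaAlgorithms1997, Table 1 (571b1)] -/
theorem exactRowZhang_5_neg8_twoSha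
    (h372 : GrossLMS1991.prop37_2_frobeniusCongruence)
    (h84 : Literature.NumberTheory.EllipticCurves.WZhang2014_lemma84_exists_minimal_kolyvaginClass_one_selmerCard)
    (K : Type) [Field K] [NumberField K] (hK : IsImaginaryQuadratic K)
    (hD : NumberField.discr K = -8) :
    haveI := isElliptic_c571b1;
    haveI := isGloballyMinimal_c571b1;
    haveI : NeZero (((⟨0, 1, 1, -4, 2⟩ : WeierstrassCurve ℤ).map (Int.castRingHom ℚ)).conductorNorm ℤ) := neZero_conductorNorm_of_isElliptic _;
    haveI := Fact.mk (by norm_num : Nat.Prime 5);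
    (∃ (Dt : ModularParametrizationData ((⟨0, 1, 1, -4, 2⟩ : WeierstrassCurve ℤ).map (Int.castRingHom ℚ)) (((⟨0, 1, 1, -4, 2⟩ : WeierstrassCurve ℤ).map (Int.castRingHom ℚ)).conductorNorm ℤ)) (β : ℤ)
      (ι : K →+* ℂ) (ℓ : ℕ) (d : KolyvaginHeegnerData Dt β ι ℓ),
      ℓ.Prime ∧ Zhang2014.IsKolyvaginPrime (((⟨0, 1, 1, -4, 2⟩ : WeierstrassCurve ℤ).map (Int.castRingHom ℚ)).conductorNorm ℤ) ((⟨0, 1, 1, -4, 2⟩ : WeierstrassCurve ℤ).map (Int.castRingHom ℚ)) K 5 ℓ ∧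
        d.kolyvaginClass (p := 5) (by norm_num) 1 ≠ 0) ↔
    ((((⟨0, 1, 1, -4, 2⟩ : WeierstrassCurve ℤ).map (Int.castRingHom ℚ)).sha ⊓ AddSubgroup.torsionBy ((⟨0, 1, 1, -4, 2⟩ : WeierstrassCurve ℤ).map (Int.castRingHom ℚ)).galH1 ((5 : ℕ) : ℤ) : AddSubgroup _) = ⊥ ∧
      (((⟨0, 1, 1, -4, 2⟩ : WeierstrassCurve ℤ).map (Int.castRingHom ℚ)).quadraticTwist (NumberField.discr K : ℚ)).mordellWeilRank = 1 ∧
      ((((⟨0, 1, 1, -4, 2⟩ : WeierstrassCurve ℤ).map (Int.castRingHom ℚ)).quadraticTwist (NumberField.discr K : ℚ)).sha ⊓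
          AddSubgroup.torsionBy (((⟨0, 1, 1, -4, 2⟩ : WeierstrassCurve ℤ).map (Int.castRingHom ℚ)).quadraticTwist (NumberField.discr K : ℚ)).galH1 ((5 : ℕ) : ℤ) :
          AddSubgroup (((⟨0, 1, 1, -4, 2⟩ : WeierstrassCurve ℤ).map (Int.castRingHom ℚ)).quadraticTwist (NumberField.discr K : ℚ)).galH1) = ⊥) := by
  haveI := isElliptic_c571b1
  haveI := isGloballyMinimal_c571b1
  haveI : NeZero (((⟨0, 1, 1, -4, 2⟩ : WeierstrassCurve ℤ).map (Int.castRingHom ℚ)).conductorNorm ℤ) := neZero_conductorNorm_of_isElliptic _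
  haveI := Fact.mk (by norm_num : Nat.Prime 5)
  have hdK : (NumberField.discr K : ℚ) ≠ 0 := by exact_mod_cast NumberField.discr_ne_zero K
  haveI := ((⟨0, 1, 1, -4, 2⟩ : WeierstrassCurve ℤ).map (Int.castRingHom ℚ)).isElliptic_quadraticTwist hdK
  have hsur : ((⟨0, 1, 1, -4, 2⟩ : WeierstrassCurve ℤ).map (Int.castRingHom ℚ)).HasSurjectiveModNGaloisRep (5 ^ 1 : ℕ) := hasSurjectiveModNGaloisRep_pow_5 1
  rw [pow_one] at hsur
  have hirrT : (((⟨0, 1, 1, -4, 2⟩ : WeierstrassCurve ℤ).map (Int.castRingHom ℚ)).quadraticTwist (NumberField.discr K : ℚ)).HasIrreducibleModPGaloisRep 5 :=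
    (((⟨0, 1, 1, -4, 2⟩ : WeierstrassCurve ℤ).map (Int.castRingHom ℚ)).hasIrreducibleModPGaloisRep_quadraticTwist_iff hdK 5).mpr
      (hasIrreducibleModPGaloisRep_of_hasSurjectiveModNGaloisRep ((⟨0, 1, 1, -4, 2⟩ : WeierstrassCurve ℤ).map (Int.castRingHom ℚ)) 5 hsur)
  have h1 : 1 ≤ (((⟨0, 1, 1, -4, 2⟩ : WeierstrassCurve ℤ).map (Int.castRingHom ℚ)).quadraticTwist (NumberField.discr K : ℚ)).mordellWeilRank := by
    rw [hD, mordellWeilRank_quadraticTwist_eq_twistModel intModel (-8), twistModel_neg8]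
    exact one_le_rank_twist_neg8
  exact (exactRowZhang_5_neg8 h372 h84 K hK hD).trans
    ((and_iff_right Summit.BirchSwinnertonDyer.BirchSwinnertonDyer.Rank2Observatory.C571b1.mordellWeilRank_eq_two).trans
      (and_congr_right fun _ ↦ natCard_selmerGroup_le_iff_rank_eq_one_sha₁₅ _ 5 hirrT h1))

end C571b1

end Summit.BirchSwinnertonDyer.BirchSwinnertonDyer.Theorems.KolyvaginDepthDoor

end
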